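import Literature.Computability.Cryptography.HallgrenClassGroup
import Literature.NumberTheory.CubicFields.BinaryCubicForms

/-!
# Stub `stub_oneSided` of line `Sketch` for the crux `ArithStatLadder.IqThreeNotPPoly`

Exact one-sidedness of the planted congruence family of binary cubic forms
`f = (N a, N b, c, e)`: if the modulus `N` is NOT squarefree, then `|Disc f|` is never a member of
the crux's set `S = {d : −d is a negative fundamental discriminant ∧ 3 ∣ h(−d)}`; in fact already
the fundamentality conjunct fails.

Mathematics. Expanding BTT (7),
`Disc f = N · (−4 a c³ + N · (b² c² − 4 N b³ e − 27 a² e² + 18 a b c e))`, so `N ∣ Disc f`.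
`¬ Squarefree N` gives a prime `p` with `p² ∣ N` (also for `N = 0`). If `p` is odd then `p² ∣ |Disc f|`
and neither `−d` nor `(−d)/4` can be squarefree. If `p = 2` then `4 ∣ N` and `16 ∣ Disc f`, so
`−d ≡ 0 (mod 4)` and `(−d)/4 ≡ 0 (mod 4)`, excluding both branches of `IsNegFundamentalDiscr`.
-/

set_option linter.dupNamespace false -- D-0017: single-problem summit ⇒ `QuantumAdvantage.QuantumAdvantage` by design

namespace Summit.QuantumAdvantage.QuantumAdvantage.Theorems.IqThreeNotPPoly

open scoped Classical
open Literature.Computability.Cryptography (IsNegFundamentalDiscr)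
open Literature.NumberTheory.QuadraticFields
open Literature.NumberTheory.CubicFields (BinaryCubic)

/-- If `16 ∣ d` then `−d` is not a negative fundamental discriminant (both residue conditions
fail: `−d ≡ 0 (mod 4)` and `(−d)/4 ≡ 0 (mod 4)`); this also covers `d = 0`. -/
theorem not_isNegFundamentalDiscr_of_sixteen_dvd {d : ℕ} (h : 16 ∣ d) :
    ¬ IsNegFundamentalDiscr d := by
  rintro (⟨h1, -, -⟩ | ⟨-, h2, -⟩) <;> omega

/-- If the square of an odd prime divides `d` then `−d` is not a negative fundamental discriminant
(neither `−d` nor `(−d)/4` is squarefree). -/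
theorem not_isNegFundamentalDiscr_of_odd_prime_sq_dvd {d p : ℕ} (hp : p.Prime) (hp2 : p ≠ 2)
    (hd : p * p ∣ d) : ¬ IsNegFundamentalDiscr d := by
  have hpu : ¬ IsUnit p := hp.not_isUnit
  rintro (⟨-, hsq, -⟩ | ⟨h4, -, hsq⟩)
  · rw [← Int.squarefree_natAbs, Int.natAbs_neg, Int.natAbs_natCast] at hsq
    exact hpu (hsq p hd)
  · have h4' : 4 ∣ d := Int.natCast_dvd_natCast.1 (dvd_neg.1 h4)
    obtain ⟨q, rfl⟩ := h4'
    have he : (-((4 * q : ℕ) : ℤ)) / 4 = -(q : ℤ) := by push_cast; omega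
    rw [he, ← Int.squarefree_natAbs, Int.natAbs_neg, Int.natAbs_natCast] at hsq
    have hcop : Nat.Coprime (p * p) 4 := by
      simpa [pow_two] using Nat.coprime_pow_primes 2 2 hp Nat.prime_two hp2
    exact hpu (hsq p (hcop.dvd_of_dvd_mul_left hd))

/-- **Stub F · `stub_oneSided`.** For a non-squarefree modulus `N`, the absolute discriminant of the
planted form `(N a, N b, c, e)` is never in the crux's set
`{d : −d fundamental ∧ 3 ∣ h(−d)}`: the fundamentality conjunct already fails, because
`Disc = N · (−4 a c³ + N · (…))` inherits the square factor of `N` (`p` odd: `p² ∣ Disc`;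
`p = 2`: `16 ∣ Disc`). -/
theorem stub_oneSided :
    ∀ (N a b c e : ℕ), ¬ Squarefree N →
      Int.natAbs (BinaryCubic.disc (R := ℤ)
        { a := (N : ℤ) * (a : ℤ), b := (N : ℤ) * (b : ℤ), c := (c : ℤ), d := (e : ℤ) }) ∉
        {d : ℕ | IsNegFundamentalDiscr d ∧ 3 ∣ BinaryQuadraticForm.classNumber (-(d : ℤ))} := by
  intro N a b c e hN hmem
  rw [Nat.squarefree_iff_prime_squarefree] at hN
  push Not at hN
  obtain ⟨p, hp, hpN⟩ := hN
  rw [Set.mem_setOf_eq] at hmem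
  obtain ⟨hfund, -⟩ := hmem
  revert hfund
  set D : ℤ := BinaryCubic.disc (R := ℤ)
    { a := (N : ℤ) * (a : ℤ), b := (N : ℤ) * (b : ℤ), c := (c : ℤ), d := (e : ℤ) } with hD
  have hdisc : D = (N : ℤ) * (-4 * a * c ^ 3 +
      N * (b ^ 2 * c ^ 2 - 4 * N * b ^ 3 * e - 27 * a ^ 2 * e ^ 2 + 18 * a * b * c * e)) := by
    simp only [hD, BinaryCubic.disc_eq]
    ring
  rcases eq_or_ne p 2 with rfl | hp2
  · -- `4 ∣ N`, hence `16 ∣ Disc`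
    obtain ⟨m, rfl⟩ := hpN
    apply not_isNegFundamentalDiscr_of_sixteen_dvd
    have h16 : ((16 : ℕ) : ℤ) ∣ D := by
      rw [hdisc]
      push_cast
      exact ⟨m * (-(a : ℤ) * c ^ 3 + m * ((b : ℤ) ^ 2 * c ^ 2 - 4 * (2 * 2 * m) * b ^ 3 * e
        - 27 * a ^ 2 * e ^ 2 + 18 * a * b * c * e)), by ring⟩
    exact Int.natCast_dvd.1 h16
  · -- `p` odd, `p² ∣ N ∣ Disc`
    apply not_isNegFundamentalDiscr_of_odd_prime_sq_dvd hp hp2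
    have hpp : ((p * p : ℕ) : ℤ) ∣ D := by
      rw [hdisc]
      exact (Int.natCast_dvd_natCast.2 hpN).mul_right _
    exact Int.natCast_dvd.1 hpp

end Summit.QuantumAdvantage.QuantumAdvantage.Theorems.IqThreeNotPPoly
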